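import Summits.Langlands.Langlands.Theorems.ExtendedAdequacySplitCoreIrreducibleProductLiftingStubProductDescentTransportIrreducible
import Summits.Langlands.Langlands.Theorems.IrreducibilityBySelfDualityIrreducibleOffSectorTensorProduct
import Literature.NumberTheory.Automorphic.GLnAdelicStructureProofs
import Literature.NumberTheory.Automorphic.RamakrishnanTensorProductGL2

/-!
# CPR `ExtendedAdequacySplit.CoreIrreducibleProductLifting` (stmt-Langlands-27081), line `birth`, stub 1/5
# `stub_productDescentTransport` (T_Π) — part 3: the `⊠` branch reduced to its AUTOMORPHIC content

Part 2 (`…StubProductDescentTransportIrreducible`, landed) reduces T_Π to the two functorialities `Sym² ⊗ χ` / `⊠` for IRREDUCIBLE geometric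
`r` in the weak-automorphy currency.  This file discharges the whole GALOIS SIDE of the `⊠` branch: given cuspidal `π₁, π₂` on `GL₂/E` with
avatars `σ₁, σ₂` and a cuspidal `P` on `GL₄/E` whose Satake parameters are the pairwise products `t_{π₁,v} ⊙ t_{π₂,v}` a.e. (Ramakrishnan's
`π₁ ⊠ π₂`), EVERY `r : Γ_E → GL₄(ℚ̄_ℓ)` with `tr r = tr σ₁ · tr σ₂` that is unramified almost everywhere is Satake–Frobenius compatible with `P`
almost everywhere — by the landed framed tensor product (`IrreducibleOffSector.exists_tensor`, `eventually_satakeFrobCompatibleAt_tensor`: the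
Kronecker avatar `σ₁ ⊗ σ₂` is compatible with `P`), `tr (σ₁ ⊗ σ₂) = tr σ₁ · tr σ₂ = tr r` (`trace_eq_mul_of_tensor_formula`), and Newton's identities in
characteristic `0` (`charpoly_eq_of_forall_trace_eq`, on the tree's `LadicLimit` Newton identities): equal traces on `Γ_E` ⇒ equal Frobenius polynomials (`eventually_satakeFrobCompatibleAt_of_forall_trace_eq`).
Hence the irreducible-form `⊠` transport `hTensorIrr` of part 2 follows from ONE purely automorphic-existence hypothesis (`tensorTransportIrr_of_cuspidalTensorLift`):

* `hRam⊠` — **CUSPIDAL, L-ALGEBRAIC RANKIN–SELBERG PRODUCT under Galois irreducibility**: for cuspidal L-algebraic `π₁, π₂` on `GL₂(𝔸_E)` with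
  a.e.-compatible `ℓ`-adic avatars `σ₁, σ₂` such that some IRREDUCIBLE `r` has `tr r = tr σ₁ · tr σ₂`, there is a CUSPIDAL L-algebraic `P` on
  `GL₄(𝔸_E)` with `t_{P,v} = t_{π₁,v} ⊙ t_{π₂,v}` for almost all `v` — Ramakrishnan, Ann. of Math. 152 (2000), Theorem M (existence of the
  isobaric `π₁ ⊠ π₂` with `(L_v)`, `(L_∞)` — whence L-algebraicity — and the cuspidality criterion §3/§11; the tree's fact
  `Ramakrishnan2000_theoremM` vendors existence and the NON-dihedral criterion at the Satake level, without the archimedean clause), the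
  cuspidality being read off the irreducibility of `r ≃ σ₁ ⊗ σ₂` (twist-equivalent `π₂ ≃ π₁ ⊗ μ` or dihedral degeneracies make `σ₁ ⊗ σ₂`
  reducible; Brauer–Nesbitt + class field theory for the twisting characters).

So after this file the EXACT REMAINING LEMMA LIST of T_Π is {`hSymIrr` (part 2), `hRam⊠`} (`stub_productDescentTransport_of_symmIrr_of_cuspidalTensorLift`).
No new definition; 0 sorry; standard axioms.
-/

set_option linter.dupNamespace false

namespace Summit.Langlands.Langlands.Theorems.CoreAdequacy.ExtAdequacy.ProductTransport

open Filter IsDedekindDomain NumberField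
open scoped MatrixGroups Kronecker NumberField Classical
open Literature.NumberTheory.GaloisRepresentations
open Literature.NumberTheory.Automorphic
open Literature.NumberTheory.PAdicHodge
open Summit.Langlands.Langlands.Theses
open Summit.Langlands.Langlands.Theorems.IrreducibleOffSector (exists_tensor isUnramifiedAt_tensor hasFrobCharpolyAt_tensor_arithFrobPolyOfSatake)

/-! ## §1 Traces of Kronecker avatars; compatibility along equal traces -/

/-- **`tr (σ ⊗ τ)(g) = tr σ(g) · tr τ(g)`** for any framed representation with the Kronecker matrix formula (Mathlib `Matrix.trace_kronecker`).
[cite: SerreLinearRepresentations1977, §1.5] -/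
theorem trace_eq_mul_of_tensor_formula {G : Type*} [Group G] [TopologicalSpace G] {A : Type*} [CommRing A] [TopologicalSpace A]
    {m n : ℕ} {σ : FramedRep G A m} {τ : FramedRep G A n} {ρT : FramedRep G A (m * n)}
    (hρT : ∀ g, ((ρT g : GL (Fin (m * n)) A) : Matrix (Fin (m * n)) (Fin (m * n)) A) =
      Matrix.reindex finProdFinEquiv finProdFinEquiv
        (((σ g : GL (Fin m) A) : Matrix (Fin m) (Fin m) A) ⊗ₖ ((τ g : GL (Fin n) A) : Matrix (Fin n) (Fin n) A)))
    (g : G) : FramedRep.trace ρT g = FramedRep.trace σ g * FramedRep.trace τ g := by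
  -- `tr (reindex e e M) = tr M` (re-indexing the diagonal sum; cf. the tree's `Literature.Barriers.ValiantsHypothesis.trace_reindex`)
  have key : ∀ M : Matrix (Fin m × Fin n) (Fin m × Fin n) A,
      (Matrix.reindex finProdFinEquiv finProdFinEquiv M).trace = M.trace := fun M => by
    simp only [Matrix.trace, Matrix.reindex_apply, Matrix.diag_apply, Matrix.submatrix_apply]
    exact finProdFinEquiv.symm.sum_comp (fun i => M i i)
  simp only [FramedRep.trace, hρT g, key, Matrix.trace_kronecker]

/-- **Equal traces on a monoid give equal characteristic polynomials** (algebraically closed coefficients of characteristic `0`): the power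
traces `tr r(g)^j = tr r(g^j)` agree, they are the power sums of the root multisets of the characteristic polynomials
(`LadicLimit.matrix_trace_pow_eq_sum_roots_pow`), and a multiset of the right cardinality is determined by its power sums (Newton,
`LadicLimit.multiset_eq_of_psum_eq`). [folklore] -/
theorem charpoly_eq_of_forall_trace_eq {G : Type*} [Monoid G] {F : Type*} [Field F] [IsAlgClosed F] [CharZero F] {n : ℕ}
    (r r' : G →* GL (Fin n) F)
    (h : ∀ g, ((r g : GL (Fin n) F) : Matrix (Fin n) (Fin n) F).trace = ((r' g : GL (Fin n) F) : Matrix (Fin n) (Fin n) F).trace)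
    (g : G) :
    ((r g : GL (Fin n) F) : Matrix (Fin n) (Fin n) F).charpoly = ((r' g : GL (Fin n) F) : Matrix (Fin n) (Fin n) F).charpoly := by
  classical
  set A : Matrix (Fin n) (Fin n) F := ((r g : GL (Fin n) F) : Matrix (Fin n) (Fin n) F) with hA
  set B : Matrix (Fin n) (Fin n) F := ((r' g : GL (Fin n) F) : Matrix (Fin n) (Fin n) F) with hB
  have hpow : ∀ j : ℕ, (A ^ j).trace = (B ^ j).trace := fun j => by
    have hj := h (g ^ j)
    rwa [map_pow, map_pow, Units.val_pow_eq_pow_val, Units.val_pow_eq_pow_val] at hj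
  have hcA : Multiset.card A.charpoly.roots = n := by
    rw [← (IsAlgClosed.splits A.charpoly).natDegree_eq_card_roots, Matrix.charpoly_natDegree_eq_dim, Fintype.card_fin]
  have hcB : Multiset.card B.charpoly.roots = n := by
    rw [← (IsAlgClosed.splits B.charpoly).natDegree_eq_card_roots, Matrix.charpoly_natDegree_eq_dim, Fintype.card_fin]
  have hroots : A.charpoly.roots = B.charpoly.roots :=
    LadicLimit.multiset_eq_of_psum_eq hcA hcB fun j _ _ => by
      rw [← LadicLimit.matrix_trace_pow_eq_sum_roots_pow, ← LadicLimit.matrix_trace_pow_eq_sum_roots_pow, hpow j]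
  rw [← Polynomial.prod_multiset_X_sub_C_of_monic_of_roots_card_eq (Matrix.charpoly_monic A) (IsAlgClosed.card_roots_eq_natDegree),
    ← Polynomial.prod_multiset_X_sub_C_of_monic_of_roots_card_eq (Matrix.charpoly_monic B) (IsAlgClosed.card_roots_eq_natDegree), hroots]

/-- **Satake–Frobenius compatibility passes along equal traces** (every rank, characteristic `0`): if `tr r = tr r'` on `Γ_E`, `r'` is compatible
with `(P, ι)` at almost all places and `r` is unramified almost everywhere, then `r` is compatible with `(P, ι)` at almost all places — equal traces
of all powers give equal characteristic polynomials (Newton, `charpoly_eq_of_forall_trace_eq`). [folklore] -/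
theorem eventually_satakeFrobCompatibleAt_of_forall_trace_eq {E : Type} [Field E] [NumberField E] {n : ℕ}
    {hcpt : isCompact_glFiniteIntegralLevel n E} {ℓ : ℕ} [Fact ℓ.Prime] (ι : PadicAlgCl ℓ ≃+* ℂ)
    (P : AutomorphicRepData (AutomorphyDatum.gl n E hcpt)) {r r' : FramedGaloisRep E (PadicAlgCl ℓ) n}
    (htr : ∀ g, FramedRep.trace r g = FramedRep.trace r' g)
    (hunr : ∀ᶠ v : HeightOneSpectrum (𝓞 E) in cofinite, r.IsUnramifiedAt v)
    (h : ∀ᶠ v : HeightOneSpectrum (𝓞 E) in cofinite, SatakeFrobCompatibleAt ι P r' v) :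
    ∀ᶠ v : HeightOneSpectrum (𝓞 E) in cofinite, SatakeFrobCompatibleAt ι P r v := by
  filter_upwards [h, hunr] with v ⟨α, hα, _, hcp⟩ hv
  refine ⟨α, hα, hv, fun 𝔓 h𝔓 s hs => ?_⟩
  rw [← hcp 𝔓 h𝔓 s hs]
  exact charpoly_eq_of_forall_trace_eq (r : Field.absoluteGaloisGroup E →* GL (Fin n) (PadicAlgCl ℓ))
    (r' : Field.absoluteGaloisGroup E →* GL (Fin n) (PadicAlgCl ℓ)) htr s

/-! ## §2 The `⊠` branch: Galois side discharged -/

/-- **Every `r` with `tr r = tr σ₁ · tr σ₂` is compatible with a tensor lift of the partners of `σ₁, σ₂`.**  If `P` on `GL₄(𝔸_E)` has Satake parameters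
`t_{π₁,v} ⊙ t_{π₂,v}` a.e., `σᵢ` is compatible with `πᵢ` a.e., `r : Γ_E → GL₄(ℚ̄_ℓ)` is a.e. unramified and `tr r = tr σ₁ · tr σ₂`, then `r` is compatible
with `P` a.e.: the Kronecker avatar (landed `exists_tensor`) is compatible with `P` (landed `isUnramifiedAt_tensor`,
`hasFrobCharpolyAt_tensor_arithFrobPolyOfSatake` — the block of `eventually_satakeFrobCompatibleAt_tensor`) and has the same traces as `r`. [cite: Ramakrishnan2000, §3.1 (P1)] -/
theorem eventually_satakeFrobCompatibleAt_of_tensor_trace {E : Type} [Field E] [NumberField E]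
    {h2 : isCompact_glFiniteIntegralLevel 2 E} {h4 : isCompact_glFiniteIntegralLevel (2 * 2) E} {ℓ : ℕ} [Fact ℓ.Prime] (ι : PadicAlgCl ℓ ≃+* ℂ)
    (π₁ π₂ : AutomorphicRepData (AutomorphyDatum.gl 2 E h2)) (P : AutomorphicRepData (AutomorphyDatum.gl (2 * 2) E h4))
    (hP : ∀ᶠ v : HeightOneSpectrum (𝓞 E) in cofinite, ∀ α β : Multiset ℂ,
      π₁.HasSatakeParamAt v α → π₂.HasSatakeParamAt v β → P.HasSatakeParamAt v (satakeTensor α β))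
    {σ₁ σ₂ : FramedGaloisRep E (PadicAlgCl ℓ) 2} {r : FramedGaloisRep E (PadicAlgCl ℓ) (2 * 2)}
    (hσ₁ : ∀ᶠ v : HeightOneSpectrum (𝓞 E) in cofinite, SatakeFrobCompatibleAt ι π₁ σ₁ v)
    (hσ₂ : ∀ᶠ v : HeightOneSpectrum (𝓞 E) in cofinite, SatakeFrobCompatibleAt ι π₂ σ₂ v)
    (hunr : ∀ᶠ v : HeightOneSpectrum (𝓞 E) in cofinite, r.IsUnramifiedAt v)
    (htr : ∀ g, FramedRep.trace r g = FramedRep.trace σ₁ g * FramedRep.trace σ₂ g) :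
    ∀ᶠ v : HeightOneSpectrum (𝓞 E) in cofinite, SatakeFrobCompatibleAt ι P r v := by
  obtain ⟨ρT, hρT⟩ := exists_tensor σ₁ σ₂
  -- the Kronecker avatar is compatible with `P` a.e. (the block of the tree's `eventually_satakeFrobCompatibleAt_tensor`)
  have hcompT : ∀ᶠ v : HeightOneSpectrum (𝓞 E) in cofinite, SatakeFrobCompatibleAt ι P ρT v := by
    filter_upwards [hP, hσ₁, hσ₂] with v hPv ⟨α, hα, hurσ, hcpσ⟩ ⟨β, hβ, hurτ, hcpτ⟩
    exact ⟨satakeTensor α β, hPv α β hα hβ, isUnramifiedAt_tensor hρT hurσ hurτ,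
      hasFrobCharpolyAt_tensor_arithFrobPolyOfSatake hρT ι v.residueCard hcpσ hcpτ⟩
  exact eventually_satakeFrobCompatibleAt_of_forall_trace_eq ι P
    (fun g => by rw [htr g, trace_eq_mul_of_tensor_formula hρT g]) hunr hcompT

/-- **The irreducible-form `⊠` transport ⟸ the cuspidal L-algebraic Rankin–Selberg product under Galois irreducibility** (`hRam⊠`, module
docstring): the hypothesis `hTensorIrr` of part 2, with its Galois side DISCHARGED.  Proof: `n = 4` (`rank_eq_four_of_tensor_shadow`); partners
`π₁, π₂` of `σ₁, σ₂` at the level structure `isCompact_glFiniteIntegralLevel_holds 2 E`; `hRam⊠` gives the cuspidal L-algebraic `P`; `r` is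
compatible with `P` a.e. by `eventually_satakeFrobCompatibleAt_of_tensor_trace`. -/
theorem tensorTransportIrr_of_cuspidalTensorLift
    (hRam : ∀ (E : Type) [Field E] [NumberField E] (h2 : isCompact_glFiniteIntegralLevel 2 E) (h4 : isCompact_glFiniteIntegralLevel 4 E)
      (ℓ : ℕ) [Fact ℓ.Prime] (ι : PadicAlgCl ℓ ≃+* ℂ) (π₁ π₂ : CuspidalAutomorphicRepData 2 E h2)
      (σ₁ σ₂ : FramedGaloisRep E (PadicAlgCl ℓ) 2) (r : FramedGaloisRep E (PadicAlgCl ℓ) 4),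
      π₁.1.IsLAlgebraic → π₂.1.IsLAlgebraic →
      (∀ᶠ v : HeightOneSpectrum (𝓞 E) in cofinite, SatakeFrobCompatibleAt ι π₁.1 σ₁ v) →
      (∀ᶠ v : HeightOneSpectrum (𝓞 E) in cofinite, SatakeFrobCompatibleAt ι π₂.1 σ₂ v) →
      r.toGaloisRep.IsIrreducible → (∀ g : Field.absoluteGaloisGroup E, FramedRep.trace r g = FramedRep.trace σ₁ g * FramedRep.trace σ₂ g) →
      ∃ P : CuspidalAutomorphicRepData 4 E h4, P.1.IsLAlgebraic ∧
        ∀ᶠ v : HeightOneSpectrum (𝓞 E) in cofinite, ∀ α β : Multiset ℂ,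
          π₁.1.HasSatakeParamAt v α → π₂.1.HasSatakeParamAt v β → P.1.HasSatakeParamAt v (satakeTensor α β)) :
    ∀ (E : Type) [Field E] [NumberField E] (n : ℕ) (ℓ : ℕ) [Fact ℓ.Prime] (ι : PadicAlgCl ℓ ≃+* ℂ)
      (r : FramedGaloisRep E (PadicAlgCl ℓ) n) (σ₁ σ₂ : FramedGaloisRep E (PadicAlgCl ℓ) 2),
      r.toGaloisRep.IsIrreducible → LieDefect.Geometric r →
      σ₁.toGaloisRep.IsIrreducible → σ₂.toGaloisRep.IsIrreducible → LieDefect.Geometric σ₁ → LieDefect.Geometric σ₂ →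
      (∀ g : Field.absoluteGaloisGroup E, FramedRep.trace r g = FramedRep.trace σ₁ g * FramedRep.trace σ₂ g) →
      (∀ hcpt₂ : isCompact_glFiniteIntegralLevel 2 E, ∃ π : CuspidalAutomorphicRepData 2 E hcpt₂, π.1.IsLAlgebraic ∧
        ∀ᶠ v : HeightOneSpectrum (𝓞 E) in cofinite, SatakeFrobCompatibleAt ι π.1 σ₁ v) →
      (∀ hcpt₂ : isCompact_glFiniteIntegralLevel 2 E, ∃ π : CuspidalAutomorphicRepData 2 E hcpt₂, π.1.IsLAlgebraic ∧
        ∀ᶠ v : HeightOneSpectrum (𝓞 E) in cofinite, SatakeFrobCompatibleAt ι π.1 σ₂ v) →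
      ∀ hcptE : isCompact_glFiniteIntegralLevel n E, ∃ π : CuspidalAutomorphicRepData n E hcptE, π.1.IsLAlgebraic ∧
        ∀ᶠ v : HeightOneSpectrum (𝓞 E) in cofinite, SatakeFrobCompatibleAt ι π.1 r v := by
  intro E _ _ n ℓ _ ι r σ₁ σ₂ hirr hgeo _ _ _ _ htr haut₁ haut₂ hcptE
  have hn4 : n = 4 := ExtAdequacy.Product.rank_eq_four_of_tensor_shadow _ htr
  subst hn4
  obtain ⟨π₁, hL₁, hc₁⟩ := haut₁ (isCompact_glFiniteIntegralLevel_holds 2 E)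
  obtain ⟨π₂, hL₂, hc₂⟩ := haut₂ (isCompact_glFiniteIntegralLevel_holds 2 E)
  obtain ⟨P, hPL, hPT⟩ := hRam E (isCompact_glFiniteIntegralLevel_holds 2 E) hcptE ℓ ι π₁ π₂ σ₁ σ₂ r hL₁ hL₂ hc₁ hc₂ hirr htr
  exact ⟨P, hPL, eventually_satakeFrobCompatibleAt_of_tensor_trace ι π₁.1 π₂.1 P.1 hPT hc₁ hc₂ hgeo.1 htr⟩

/-! ## §3 T_Π ⟸ {`hSymIrr`, `hRam⊠`} -/

/-- **T_Π from the irreducible-form `Sym² ⊗ χ` transport and the cuspidal L-algebraic `⊠` product** — the registered stub VERBATIM; the `⊠` half of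
part 2's reduction with its Galois side discharged (`tensorTransportIrr_of_cuspidalTensorLift`). -/
theorem stub_productDescentTransport_of_symmIrr_of_cuspidalTensorLift
    (hSymIrr : ∀ (E : Type) [Field E] [NumberField E] (n : ℕ) (ℓ : ℕ) [Fact ℓ.Prime] (ι : PadicAlgCl ℓ ≃+* ℂ)
      (r : FramedGaloisRep E (PadicAlgCl ℓ) n) (σ : FramedGaloisRep E (PadicAlgCl ℓ) 2) (χ : FramedGaloisRep E (PadicAlgCl ℓ) 1),
      r.toGaloisRep.IsIrreducible → LieDefect.Geometric r → σ.toGaloisRep.IsIrreducible → LieDefect.Geometric σ → LieDefect.Geometric χ →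
      (∀ g : Field.absoluteGaloisGroup E,
        2 * FramedRep.trace r g = FramedRep.trace χ g * (FramedRep.trace σ g ^ 2 + FramedRep.trace σ (g * g))) →
      (∀ hcpt₂ : isCompact_glFiniteIntegralLevel 2 E, ∃ π : CuspidalAutomorphicRepData 2 E hcpt₂, π.1.IsLAlgebraic ∧
        ∀ᶠ v : HeightOneSpectrum (𝓞 E) in cofinite, SatakeFrobCompatibleAt ι π.1 σ v) →
      (∀ hcpt₁ : isCompact_glFiniteIntegralLevel 1 E, ∃ π : CuspidalAutomorphicRepData 1 E hcpt₁, π.1.IsLAlgebraic ∧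
        ∀ᶠ v : HeightOneSpectrum (𝓞 E) in cofinite, SatakeFrobCompatibleAt ι π.1 χ v) →
      ∀ hcptE : isCompact_glFiniteIntegralLevel n E, ∃ π : CuspidalAutomorphicRepData n E hcptE, π.1.IsLAlgebraic ∧
        ∀ᶠ v : HeightOneSpectrum (𝓞 E) in cofinite, SatakeFrobCompatibleAt ι π.1 r v)
    (hRam : ∀ (E : Type) [Field E] [NumberField E] (h2 : isCompact_glFiniteIntegralLevel 2 E) (h4 : isCompact_glFiniteIntegralLevel 4 E)
      (ℓ : ℕ) [Fact ℓ.Prime] (ι : PadicAlgCl ℓ ≃+* ℂ) (π₁ π₂ : CuspidalAutomorphicRepData 2 E h2)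
      (σ₁ σ₂ : FramedGaloisRep E (PadicAlgCl ℓ) 2) (r : FramedGaloisRep E (PadicAlgCl ℓ) 4),
      π₁.1.IsLAlgebraic → π₂.1.IsLAlgebraic →
      (∀ᶠ v : HeightOneSpectrum (𝓞 E) in cofinite, SatakeFrobCompatibleAt ι π₁.1 σ₁ v) →
      (∀ᶠ v : HeightOneSpectrum (𝓞 E) in cofinite, SatakeFrobCompatibleAt ι π₂.1 σ₂ v) →
      r.toGaloisRep.IsIrreducible → (∀ g : Field.absoluteGaloisGroup E, FramedRep.trace r g = FramedRep.trace σ₁ g * FramedRep.trace σ₂ g) →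
      ∃ P : CuspidalAutomorphicRepData 4 E h4, P.1.IsLAlgebraic ∧
        ∀ᶠ v : HeightOneSpectrum (𝓞 E) in cofinite, ∀ α β : Multiset ℂ,
          π₁.1.HasSatakeParamAt v α → π₂.1.HasSatakeParamAt v β → P.1.HasSatakeParamAt v (satakeTensor α β)) :
    ExtendedAdequacySplit.OdlyzkoWorldAutomorphy → ExtendedAdequacySplit.TransOdlyzkoAutomorphy →
      ExtendedAdequacySplit.SatakeAvatarExistence → ExtendedAdequacySplit.CliffordSolvableDescent →
        ExtendedAdequacySplit.CoreIrreducibleProductLifting :=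
  stub_productDescentTransport_of_irreducibleTransport hSymIrr (tensorTransportIrr_of_cuspidalTensorLift hRam)

end Summit.Langlands.Langlands.Theorems.CoreAdequacy.ExtAdequacy.ProductTransport
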